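import Summits.QuantumFields.BalabanUV.Beta.FP.TowerDoorDefectLoc
import Summits.QuantumFields.BalabanUV.Beta.FP.RepAlgebraTsum
import Literature.MathematicalPhysics.QuantumFieldTheory.Balaban1983to89.Beta.KernelReflection

/-!
# `BalabanUV.Beta.FP.TowerDoorDefectTadpole` — binder row D1, the row's ONE file, **(X) IN TADPOLE FORM** (J-NOTE-21 §7 (A), route (a)):
# `tadpole A (doorZ L tabs κ₂ κΔ lam S μ y ν y′) = κΔ · Σ_κ Σ'_{y₀} (S ν y′ κ y₀ · tadpole A (defKerZ … (lam μ y) (y₀,κ)) + S μ y κ y₀ · tadpole A (defKerZ … (lam ν y′) (y₀,κ)))`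
# for a chart decaying at the tables' half rate, (Lmix)∕(LH) tables, uniformly bounded gauge functions and `ℓ¹` read-out columns — p670056 §5's `hX` letter up to the identification
# `τ j κ y₀ v = κτ · tadpole A (defKerZ … v (y₀,κ))` (whose `ℓ¹`-pairing form is the `ω`-exhibition, J-NOTE-21 §7 (B)); ONE application of PART 63 `tadpole_tsumKer` over the index
# `(Fin 4 × Site) ⊕ (Fin 4 × Site)` with PART 64's `biLoc_defKerZ`, the rest being `tsum` regrouping (`Summable.tsum_sum`, `Summable.tsum_prod'`, `tsum_fintype`, `Summable.tsum_add`)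
# (β-function cell `pub-balaban`, BINDER-OWNERS row D1 ∕ (C1) OWNER «beta-an2» gen 77, PART 65; imports PART 64 + PART 63 + lit `KernelReflection`)

WHAT ([folklore] `tsum` regrouping + PART 63∕64 BY NAME; no `def`, no `def … : Prop`, nothing cited, 0 sorry, default heartbeats).
§1 generic regrouping over a finite first factor: `summable_uncurry_of_fintype` (`∀ k, Σ_s |g k s| < ∞ ⟹ Summable (uncurry g)` — `summable_prod_of_nonneg` + `Summable.of_finite`),
**`tsum_sumElim_uncurry_eq`** (`Σ' i : (κ × σ) ⊕ (κ × σ), Sum.elim (uncurry g₁) (uncurry g₂) i = Σ_k Σ'_s (g₁ k s + g₂ k s)`).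
§2 **`tadpole_doorZ`** — the identity above, hypotheses: `Decays A CA (δ/2)`, `0 < δ`, `LocStencilFM L tabs.mixFF C δ`, `VertexFamily tabs.H L C_H (δ/2)`, `∀ μ y u, |lam μ y u| ≤ V`, `∀ ν z κ, Σ_{y₀} |S ν z κ y₀| < ∞`;
`summable_S_mul_tadpole_defKerZ` (the right side's series converge absolutely — PART 63 `summable_mul_tadpole`).
WHAT THIS IS NOT: not the `ω`-exhibition (so not yet v10's `hX` with ITS `τd`), not the record instance, not (T2); nothing of Bałaban's asserted, valued or discharged; 0 estimates (bookkeeping constants); 0∕4 row-D1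
binders (hW, hR, D1Tel, D1Rep); NOT (C1), NOT D1, NEVER «G-an2-4 closed», NOT BetaPertH, NOT continuum, NOT Clay.

HONEST DEPENDENCY (page 1, mandatory): continuum YM on T⁴ ⇐ BetaPertH ∧ nine spine estimates (0/9 proved); BetaPertH ⇐ (D1) ∧ (D4) ∧ CAP+tail;
G-an2-4 gates asym, D1 and NE2/3/4.  HONEST FRAMING (cell contract, verbatim): «discharging `BetaPertH` makes Bałaban's UV stability UNCONDITIONAL —
a real constructive-QFT result; it is NOT the continuum limit and NOT the Clay problem.»  ABSOLUTE RULE (cell charter, verbatim): «No internally-minted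
statement may enter as a cited fact. Every hypothesis is either kernel-proved in this package or a verbatim quotation of a PUBLISHED theorem with page
reference. The manuscript(s) under audit are NOT citable for their own disputed steps — they are the thing under adjudication; programme-internal
(2001/route/tribunal) claims are never citable.»  Row D1 ∕ (C1) OWNER «beta-an2» gen 77, 2026-08-29.  No existing file touched.
-/

noncomputable section

open Finset
open scoped BigOperators
open Literature.MathematicalPhysics.QuantumFieldTheory
open Literature.MathematicalPhysics.QuantumFieldTheory.Balaban1983to89
open Literature.MathematicalPhysics.QuantumFieldTheory.Balaban1983to89.Beta
open Literature.MathematicalPhysics.QuantumFieldTheory.Balaban1983to89.B12Sec2to5 (l1 l1_nonneg)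
open AffineAveraging (Site unitVec)
open OneStepResolventKernel (Fib)
open ExpKernelCalculus (MKer BiLoc Decays VertexFamily Zl Zl_nonneg tadpole)
open SecondOrderResponse (LocStencilFM)
open KernelReflection (tadpole_smul)
open BalabanStepW2 (wM2)
open Summit.QuantumFields.BalabanUV.Beta.SymmetrisedStepJets (SymTables)
open Summit.QuantumFields.BalabanUV.Beta.FP.RepAlgebraTrace (abs_le_of_biLoc)
open Summit.QuantumFields.BalabanUV.Beta.FP.RepAlgebraTsum (tadpole_tsumKer summable_mul_tadpole)
open Summit.QuantumFields.BalabanUV.Beta.FP.TowerDoorDefectDefs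
open Summit.QuantumFields.BalabanUV.Beta.FP.TowerDoorDefectLoc (biLoc_defKerZ)

namespace Summit.QuantumFields.BalabanUV.Beta.FP.TowerDoorDefectTadpole

/-! ## §1 Regrouping a series over `(κ × σ) ⊕ (κ × σ)` with a finite first factor -/

section Regroup

variable {κ σ : Type*} [Fintype κ]

/-- [folklore] finitely many absolutely summable fibres make a summable family on the product. -/
theorem summable_uncurry_of_fintype (g : κ → σ → ℝ) (h : ∀ k, Summable fun s => |g k s|) :
    Summable (Function.uncurry g) := by
  have habs : Summable (fun p : κ × σ => |Function.uncurry g p|) := by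
    rw [summable_prod_of_nonneg (fun p => abs_nonneg _)]
    exact ⟨fun k => h k, Summable.of_finite⟩
  exact habs.of_abs

/-- [folklore] **`tsum_sumElim_uncurry_eq`** — `Σ' i : (κ × σ) ⊕ (κ × σ), Sum.elim (uncurry g₁) (uncurry g₂) i = Σ_k Σ'_s (g₁ k s + g₂ k s)` (`Summable.tsum_sum` for the two halves, `Summable.tsum_prod'` +
`tsum_fintype` for the finite factor, `Summable.tsum_add` fibrewise). -/
theorem tsum_sumElim_uncurry_eq (g₁ g₂ : κ → σ → ℝ) (h₁ : ∀ k, Summable fun s => |g₁ k s|) (h₂ : ∀ k, Summable fun s => |g₂ k s|) :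
    (∑' i : (κ × σ) ⊕ (κ × σ), Sum.elim (Function.uncurry g₁) (Function.uncurry g₂) i) = ∑ k, ∑' s, (g₁ k s + g₂ k s) := by
  have hu₁ := summable_uncurry_of_fintype g₁ h₁
  have hu₂ := summable_uncurry_of_fintype g₂ h₂
  have e₁ : (∑' p : κ × σ, Function.uncurry g₁ p) = ∑ k, ∑' s, g₁ k s := by
    rw [hu₁.tsum_prod' (fun k => (h₁ k).of_abs), tsum_fintype]
    rfl
  have e₂ : (∑' p : κ × σ, Function.uncurry g₂ p) = ∑ k, ∑' s, g₂ k s := by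
    rw [hu₂.tsum_prod' (fun k => (h₂ k).of_abs), tsum_fintype]
    rfl
  rw [Summable.tsum_sum (by exact hu₁) (by exact hu₂)]
  show (∑' p : κ × σ, Function.uncurry g₁ p) + (∑' p : κ × σ, Function.uncurry g₂ p) = _
  rw [e₁, e₂, ← Finset.sum_add_distrib]
  refine Finset.sum_congr rfl fun k _ => ?_
  rw [((h₁ k).of_abs).tsum_add ((h₂ k).of_abs)]

/-- [folklore] the absolute values regroup the same way into a summable family on the `⊕`-index. -/
theorem summable_abs_sumElim_uncurry (g₁ g₂ : κ → σ → ℝ) (h₁ : ∀ k, Summable fun s => |g₁ k s|) (h₂ : ∀ k, Summable fun s => |g₂ k s|) :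
    Summable (fun i : (κ × σ) ⊕ (κ × σ) => |Sum.elim (Function.uncurry g₁) (Function.uncurry g₂) i|) := by
  refine Summable.sum _ ?_ ?_
  · show Summable (fun p : κ × σ => |Function.uncurry g₁ p|)
    rw [summable_prod_of_nonneg (fun p => abs_nonneg _)]
    exact ⟨fun k => h₁ k, Summable.of_finite⟩
  · show Summable (fun p : κ × σ => |Function.uncurry g₂ p|)
    rw [summable_prod_of_nonneg (fun p => abs_nonneg _)]
    exact ⟨fun k => h₂ k, Summable.of_finite⟩

end Regroup

/-! ## §2 The tadpole through the door's superposition -/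

section Door

variable (L : ℕ) (tabs : SymTables 3 L)

/-- [folklore] **`tadpole_doorZ` — (X) IN TADPOLE FORM**: for a chart `A` with `Decays A CA (δ/2)`, tables with (Lmix) `LocStencilFM L tabs.mixFF C δ` (`δ > 0`) and (LH) `VertexFamily tabs.H L C_H (δ/2)`, gauge
functions bounded by `V` and `ℓ¹` read-out columns,
`tadpole A (doorZ L tabs κ₂ κΔ lam S μ y ν y′) = κΔ · Σ_κ Σ'_{y₀} (S ν y′ κ y₀ · tadpole A (defKerZ … (lam μ y) (y₀,κ)) + S μ y κ y₀ · tadpole A (defKerZ … (lam ν y′) (y₀,κ)))`. -/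
theorem tadpole_doorZ {A : MKer (3 + 1) (Fib 3)} {CA C δ C_H : ℝ} (hδ : 0 < δ) (hA : Decays A CA (δ / 2))
    (hmix : LocStencilFM L tabs.mixFF C δ) (hH : VertexFamily tabs.H L C_H (δ / 2)) (κ₂ κΔ : ℝ)
    {lam : Fin (3 + 1) → Site (3 + 1) → (Site (3 + 1) → ℝ)} {V : ℝ} (hV : 0 ≤ V) (hlam : ∀ μ y u, |lam μ y u| ≤ V)
    {S : Fin (3 + 1) → Site (3 + 1) → Fin (3 + 1) → Site (3 + 1) → ℝ} (hS : ∀ ν z κ, Summable fun y₀ => |S ν z κ y₀|)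
    (μ : Fin (3 + 1)) (y : Site (3 + 1)) (ν : Fin (3 + 1)) (y' : Site (3 + 1)) :
    tadpole A (doorZ L tabs κ₂ κΔ lam S μ y ν y')
      = κΔ * ∑ κ : Fin (3 + 1), ∑' y₀ : Site (3 + 1),
          (S ν y' κ y₀ * tadpole A (defKerZ L tabs κ₂ (lam μ y) (y₀, κ))
            + S μ y κ y₀ * tadpole A (defKerZ L tabs κ₂ (lam ν y') (y₀, κ))) := by
  have hδ2 : 0 < δ / 2 := half_pos hδ
  -- the common bi-localisation constant of the defect kernels (PART 64)
  set KT : ℝ := ((3 + 1 : ℕ) : ℝ) * (2 * V * (|wM2 3 L 0| * C) * Zl (3 + 1) (δ / 2)) + 2 * |κ₂| * V * C_H with hKT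
  have hC : 0 ≤ C := hmix.nonneg
  have hCH : 0 ≤ C_H := (hH 0 0).nonneg (Sum.inl 0)
  have hKT0 : 0 ≤ KT := by rw [hKT]; have := Zl_nonneg (D := 3 + 1) hδ2; positivity
  have hT₁ : ∀ (κ : Fin (3 + 1)) (y₀ : Site (3 + 1)), BiLoc (defKerZ L tabs κ₂ (lam μ y) (y₀, κ)) (((L : ℕ) : ℤ) • y₀) (((L : ℕ) : ℤ) • y₀) KT (δ / 2) :=
    fun κ y₀ => biLoc_defKerZ L tabs hmix hδ hH κ₂ hV (hlam μ y) (y₀, κ)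
  have hT₂ : ∀ (κ : Fin (3 + 1)) (y₀ : Site (3 + 1)), BiLoc (defKerZ L tabs κ₂ (lam ν y') (y₀, κ)) (((L : ℕ) : ℤ) • y₀) (((L : ℕ) : ℤ) • y₀) KT (δ / 2) :=
    fun κ y₀ => biLoc_defKerZ L tabs hmix hδ hH κ₂ hV (hlam ν y') (y₀, κ)
  -- the `⊕`-indexed presentation
  let c : (Fin (3 + 1) × Site (3 + 1)) ⊕ (Fin (3 + 1) × Site (3 + 1)) → ℝ :=
    Sum.elim (fun p => S ν y' p.1 p.2) (fun p => S μ y p.1 p.2)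
  let T : (Fin (3 + 1) × Site (3 + 1)) ⊕ (Fin (3 + 1) × Site (3 + 1)) → MKer (3 + 1) (Fib 3) :=
    Sum.elim (fun p => defKerZ L tabs κ₂ (lam μ y) (p.2, p.1)) (fun p => defKerZ L tabs κ₂ (lam ν y') (p.2, p.1))
  let pc : (Fin (3 + 1) × Site (3 + 1)) ⊕ (Fin (3 + 1) × Site (3 + 1)) → Site (3 + 1) :=
    Sum.elim (fun p => ((L : ℕ) : ℤ) • p.2) (fun p => ((L : ℕ) : ℤ) • p.2)
  have hTi : ∀ i, BiLoc (T i) (pc i) (pc i) KT (δ / 2) := by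
    rintro (p | p)
    · exact hT₁ p.1 p.2
    · exact hT₂ p.1 p.2
  have hc : Summable (fun i => |c i|) := by
    have h := summable_abs_sumElim_uncurry (fun κ y₀ => S ν y' κ y₀) (fun κ y₀ => S μ y κ y₀) (fun κ => hS ν y' κ) (fun κ => hS μ y κ)
    convert h using 2 with i
    rcases i with p | p <;> rfl
  -- PART 63, once
  have key := tadpole_tsumKer hA hδ2 hKT0 hTi hc
  -- the door IS `κΔ •` that superposition
  have hker : doorZ L tabs κ₂ κΔ lam S μ y ν y' = κΔ • (fun x z a b => ∑' i, c i * T i x z a b) := by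
    funext x z a b
    rw [doorZ_apply]
    show _ = κΔ * ∑' i, c i * T i x z a b
    congr 1
    have h₁ : ∀ κ : Fin (3 + 1), Summable fun y₀ : Site (3 + 1) => |S ν y' κ y₀ * defKerZ L tabs κ₂ (lam μ y) (y₀, κ) x z a b| := by
      intro κ
      refine Summable.of_nonneg_of_le (fun _ => abs_nonneg _) (fun y₀ => ?_) ((hS ν y' κ).mul_right KT)
      rw [abs_mul]
      exact mul_le_mul_of_nonneg_left (abs_le_of_biLoc (hT₁ κ y₀) hδ2.le x z a b) (abs_nonneg _)
    have h₂ : ∀ κ : Fin (3 + 1), Summable fun y₀ : Site (3 + 1) => |S μ y κ y₀ * defKerZ L tabs κ₂ (lam ν y') (y₀, κ) x z a b| := by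
      intro κ
      refine Summable.of_nonneg_of_le (fun _ => abs_nonneg _) (fun y₀ => ?_) ((hS μ y κ).mul_right KT)
      rw [abs_mul]
      exact mul_le_mul_of_nonneg_left (abs_le_of_biLoc (hT₂ κ y₀) hδ2.le x z a b) (abs_nonneg _)
    have e := tsum_sumElim_uncurry_eq (fun κ y₀ => S ν y' κ y₀ * defKerZ L tabs κ₂ (lam μ y) (y₀, κ) x z a b)
      (fun κ y₀ => S μ y κ y₀ * defKerZ L tabs κ₂ (lam ν y') (y₀, κ) x z a b) h₁ h₂
    rw [← e]
    refine tsum_congr fun i => ?_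
    rcases i with p | p <;> rfl
  rw [hker, tadpole_smul, key]
  congr 1
  -- regroup the scalar series the same way
  have g₁ : ∀ κ : Fin (3 + 1), Summable fun y₀ : Site (3 + 1) => |S ν y' κ y₀ * tadpole A (defKerZ L tabs κ₂ (lam μ y) (y₀, κ))| := by
    intro κ
    have h := summable_mul_tadpole hA hδ2 (fun y₀ => hT₁ κ y₀) (hS ν y' κ)
    exact h.abs
  have g₂ : ∀ κ : Fin (3 + 1), Summable fun y₀ : Site (3 + 1) => |S μ y κ y₀ * tadpole A (defKerZ L tabs κ₂ (lam ν y') (y₀, κ))| := by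
    intro κ
    have h := summable_mul_tadpole hA hδ2 (fun y₀ => hT₂ κ y₀) (hS μ y κ)
    exact h.abs
  have e := tsum_sumElim_uncurry_eq (fun κ y₀ => S ν y' κ y₀ * tadpole A (defKerZ L tabs κ₂ (lam μ y) (y₀, κ)))
    (fun κ y₀ => S μ y κ y₀ * tadpole A (defKerZ L tabs κ₂ (lam ν y') (y₀, κ))) g₁ g₂
  rw [← e]
  refine tsum_congr fun i => ?_
  rcases i with p | p <;> rfl

end Door

end Summit.QuantumFields.BalabanUV.Beta.FP.TowerDoorDefectTadpole

end
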